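import Summits.QuantumFields.BalabanUV.T4Continuum.Support.NE7ApeTrivialFlatEndLinks
import Summits.QuantumFields.BalabanUV.T4Continuum.Support.NE7AxisHolonomyRecurrence
import HarnessLib

/-!
# NE7ApeFlatEndOfRobustEnd — A REDUCTION: a ROBUST (APE) END at ALMOST-trivial axis holonomies (the OWNER's D8 ∕ this lineage's D9 §3 with
# `D([0,(N·m)e_i]) = 1` weakened to `‖D([0,(N·m)e_i]) − 1‖ ≤ η` and an `(N,m)`-uniform `+ C·η` in the conclusion) would give the END on the fibre over
# EVERY flat datum — infinite-order holonomy included — by Kronecker recurrence on the covers and the closedness of the small-field class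

Cell `pub-balaban`, rung (B)+1 sub-cell t4, lineage `b2b-balaban-t4-ne7-p2`, generation 89 (CRUX PROVER NE7 #2 = co-owner of row NE7, kernel hand); file (T′)
of the gen-89 line, over (R) `NE7AxisHolonomyRecurrence` and the vocabulary of the OWNER's D8 (`NE7ApeTrivialFlatEndLinks`, t4-ne7-p1).
WHY.  After D9 ∕ D11 the (APE) END holds on the fibre over every flat datum whose holonomy constants have FINITE order modulo the centre.  The remaining flat
data (infinite order) looked like they need the twisted-torus dictionary (D8's whole torus analysis under `U(x+Pe_j) = Ad_{h_j}U(x)`).  They do not, IF the END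
is ROBUST in the axis holonomies: on the `m`-fold cover the `(N·m)`-fold axis holonomies of the datum are the powers `h_i^m`, which return within any `ε` of
`1` for suitable `m` ((R) `exists_axis_holonomy_pow_near_one`), so a robust END with an `(N,m)`-UNIFORM defect constant `C` gives `SmallField U (K′δ²∕M² + ε)`
for every `ε > 0`, and the small-field class is closed (`smallField_of_forall_pos`).  The uniformity in `m` is essential (recurrence has no rate); it is the
same kind of uniformity D8 already has in `N`.  THIS FILE IS THE REDUCTION ONLY: the robust END is the displayed hypothesis `hRobust`, proved nowhere.
WHAT ([folklore]; 0 def, 0 sorry).  §1 `smallField_of_forall_pos` (closedness of `SmallField U a` in `a`); §2 **`smallField_of_tanCritical_flatDatum_of_robustEnd`**: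
`hRobust` (D9 §3's hypotheses with `‖D([0,(N·m)e_i]) − 1‖ ≤ η` in place of `= 1`, conclusion `SmallField U (K′δ²∕M² + C·η)`, for all `N, m ≥ 1`) ⟹ for
EVERY flat datum (coarse plaquettes `1`, NO holonomy hypothesis): `SmallField U (K′δ²∕M²)`.
HONEST FRAMING (page 1): a reduction with a displayed unproved hypothesis (the robust END); elementary given (R); nothing of Bałaban's asserted; moves no
letter by itself; (APE) on the data class `𝒟_β` NOT proved; NE7 NOT PRINTED ∕ NOT PROVED; spine PROVED 0∕9; FIXED FINITE T⁴, rung (B)+1 — NOT infinite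
volume, NOT mass gap, NOT BetaPertH, NOT Clay.  Continuum YM on T⁴ ⇐ BetaPertH ∧ nine spine estimates (0/9 proved); BetaPertH ⇐ (D1) ∧ (D4) ∧ CAP+tail;
G-an2-4 gates asym, D1 and NE2/3/4.
-/

set_option autoImplicit false

open scoped BigOperators Matrix.Norms.L2Operator
open NormedSpace Finset

namespace Summit.QuantumFields.BalabanUV.T4Continuum.NE7ApeFlatEndOfRobustEnd

open Literature.MathematicalPhysics.QuantumFieldTheory.Balaban1983to89
open B7Prop1Explicit B7Prop2Explicit
open T4AveragingDeficitWall (IsUnitaryCfg IsSkewDir SmallField)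
open T4AveragingDeficitWallBoundary (IsPeriodicCfg)
open AveragingDeficitPeriodicCounting (IsPeriodicDir)
open AveragingDeficitMultiLevelPrep (cavgIter LevelSmall cavgIter_unitary_small isPeriodicCfg_cavgIter)
open MinimalActionLevels (perWin)
open NE3HessForm (dAction)
open NE3TangentCovariantTower (dirIter)
open NE3QbarIterCovLiftPrep (cruxC)
open NE3RightInverseSolveLetters (thetaLoc)
open NE3SmoothLiftW (tower_eq_pow_mul)
open NE7AxisHolonomyRecurrence (exists_axis_holonomy_pow_near_one)

noncomputable section

variable {d : ℕ} {n : Type*} [Fintype n] [DecidableEq n]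

/-! ## §1 The small-field class is closed in the radius -/

/-- `SmallField U (a + ε)` for every `ε > 0` gives `SmallField U a`. [folklore] -/
theorem smallField_of_forall_pos {U : Site d → Fin d → (Matrix n n ℂ)ˣ} {a : ℝ} (h : ∀ ε : ℝ, 0 < ε → SmallField U (a + ε)) :
    SmallField U a := by
  intro x κ κ' hκ
  exact le_of_forall_pos_le_add fun ε hε => h ε hε x κ κ' hκ

/-! ## §2 The reduction: a robust END on the covers gives the END over every flat datum -/

/-- **THE END OVER EVERY FLAT DATUM FROM A ROBUST END AT ALMOST-TRIVIAL AXIS HOLONOMIES.**  Hypothesis `hRobust` (NOT proved in the tree): for all `N, m ≥ 1`,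
`k`, every unitary `(L^{k+1}N)`-periodic `U` of the multi-level class, `SmallField U (δ∕M²)`, `0 ≤ δ ≤ θ`, `δ∕M² ≤ x`, tangent-critical at period `L^{k+1}N`, whose
`(k+1)`-fold average `D` is flat with `‖D([0,(N·m)e_i]) − 1‖ ≤ η` for every axis: `SmallField U (K′δ²∕M² + C·η)` — `K′, θ, C` uniform in `N` AND `m`.  Conclusion:
the same with NO holonomy hypothesis and NO defect — `SmallField U (K′δ²∕M²)` on the fibre over EVERY flat datum. [folklore] -/
theorem smallField_of_tanCritical_flatDatum_of_robustEnd {n : Type} [Fintype n] [DecidableEq n] [Nonempty n] {L : ℕ} (hL : 2 ≤ L) {K' θ C : ℝ}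
    (hC : 0 < C)
    (hRobust : ∀ (N : ℕ) [NeZero N] (m : ℕ) [NeZero m] (k : ℕ)
      {U : Site (d + 1) → Fin (d + 1) → (Matrix n n ℂ)ˣ} (_hU : IsUnitaryCfg U) {x δ η : ℝ} (_hx : 0 ≤ x) (_hs : LevelSmall (d + 1) L k x)
      (_hUx : SmallField U x) (_hδ : 0 ≤ δ) (_hUδ : SmallField U (δ / ((L : ℝ) ^ (k + 1)) ^ 2)) (_hδx : δ / ((L : ℝ) ^ (k + 1)) ^ 2 ≤ x)
      (_hcritU : ∀ φ : Site (d + 1) → Fin (d + 1) → Matrix n n ℂ, IsSkewDir φ → IsPeriodicDir φ ((L ^ (k + 1) * N : ℕ) : ℤ) →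
        dirIter L (k + 1) U φ = 0 → dAction U φ (perWin (d + 1) (L ^ (k + 1) * N)) = 0)
      (_hflatD : ∀ (y : Site (d + 1)) (κ μ : Fin (d + 1)), κ ≠ μ → hol (cavgIter L (k + 1) U) y (plaqWord κ μ) = 1)
      (_hholD : ∀ i : Fin (d + 1), ‖((hol (cavgIter L (k + 1) U) 0 (seg i (((N * m : ℕ) : ℤ))) : (Matrix n n ℂ)ˣ) : Matrix n n ℂ) - 1‖ ≤ η)
      (_hUP : IsPeriodicCfg U ((L ^ (k + 1) * N : ℕ) : ℤ))
      (_hθ : cruxC (d + 1) L * (((L : ℝ) ^ (k + 1)) ^ 2 * x) < 1) (_hθl : thetaLoc (d + 1) L * (((L : ℝ) ^ (k + 1)) ^ 2 * x) ≤ 1 / 2)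
      (_hε : ((L : ℝ) ^ (k + 1)) ^ 2 * x ≤ 1) (_hδθ : δ ≤ θ),
      SmallField U (K' * δ ^ 2 / ((L : ℝ) ^ (k + 1)) ^ 2 + C * η))
    (N : ℕ) [NeZero N] (k : ℕ)
    {U : Site (d + 1) → Fin (d + 1) → (Matrix n n ℂ)ˣ} (hU : IsUnitaryCfg U) {x δ : ℝ} (hx : 0 ≤ x) (hs : LevelSmall (d + 1) L k x)
    (hUx : SmallField U x) (hδ : 0 ≤ δ) (hUδ : SmallField U (δ / ((L : ℝ) ^ (k + 1)) ^ 2)) (hδx : δ / ((L : ℝ) ^ (k + 1)) ^ 2 ≤ x)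
    (hcritU : ∀ φ : Site (d + 1) → Fin (d + 1) → Matrix n n ℂ, IsSkewDir φ → IsPeriodicDir φ ((L ^ (k + 1) * N : ℕ) : ℤ) →
      dirIter L (k + 1) U φ = 0 → dAction U φ (perWin (d + 1) (L ^ (k + 1) * N)) = 0)
    (hflatD : ∀ (y : Site (d + 1)) (κ μ : Fin (d + 1)), κ ≠ μ → hol (cavgIter L (k + 1) U) y (plaqWord κ μ) = 1)
    (hUP : IsPeriodicCfg U ((L ^ (k + 1) * N : ℕ) : ℤ))
    (hθ : cruxC (d + 1) L * (((L : ℝ) ^ (k + 1)) ^ 2 * x) < 1) (hθl : thetaLoc (d + 1) L * (((L : ℝ) ^ (k + 1)) ^ 2 * x) ≤ 1 / 2)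
    (hε : ((L : ℝ) ^ (k + 1)) ^ 2 * x ≤ 1) (hδθ : δ ≤ θ) :
    SmallField U (K' * δ ^ 2 / ((L : ℝ) ^ (k + 1)) ^ 2) := by
  have hL1 : 1 ≤ L := by omega
  -- the datum is unitary and `N`-periodic
  have hDu : IsUnitaryCfg (cavgIter L (k + 1) U) := (cavgIter_unitary_small hL1 k hU hx hs hUx).1
  have hDP : IsPeriodicCfg (cavgIter L (k + 1) U) (N : ℤ) := by
    refine isPeriodicCfg_cavgIter L N (k + 1) ?_
    rw [tower_eq_pow_mul]
    exact hUP
  refine smallField_of_forall_pos fun ε hεpos => ?_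
  -- a cover on which every axis holonomy is within `ε∕C` of `1`
  obtain ⟨m, hm, hmε⟩ := exists_axis_holonomy_pow_near_one hDu hDP (div_pos hεpos hC)
  haveI : NeZero m := ⟨by omega⟩
  have h := hRobust N m k hU hx hs hUx hδ hUδ hδx hcritU hflatD (fun i => (hmε i).le) hUP hθ hθl hε hδθ
  have hCε : C * (ε / C) = ε := by field_simp
  rwa [hCε] at h

end

end Summit.QuantumFields.BalabanUV.T4Continuum.NE7ApeFlatEndOfRobustEnd
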